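import Summits.CriticalPhenomena.PercolationContinuityZ3.Theses.PercExchangeRateTransport
import Summits.CriticalPhenomena.PercolationContinuityZ3.Theorems.SubcritExchangeUniformity.Negative.DiagonalIdentity

/-!
# `SupercritExchangeUniformity` (K⁺, crux stmt-CriticalPhenomena-16061, route `PercExchangeRateTransport`),
# negative lane, part 2: the diagonal pins the K⁺ field — `a(t,t) = 1/2` on the diagonal segment of the collar

Tightness material from the crux disprover of K⁺ (cdisprove, cycle 1); nothing here asserts a Theses
decl positively; no definitions. Objects as in the sibling lane
`…Theorems.SubcritExchangeUniformity.Negative.Objects` (`ThetaBox = Θ`, `pcurve = pc` of the crux, by `rfl`).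

By cubic symmetry the finite-volume exchange rate is EXACTLY `1/2` on the diagonal for every `n`
(`Diag.deriv_p_eq_two_mul_deriv_t_diag`: `∂_pΘ_n(p,p) = 2 ∂_tΘ_n(p,p)`, `p ∈ (0,1)`), and
`∂_tΘ_n > 0` there (`deriv_t_pos`). Consequences for K⁺, whose field `a(p,t)` lives on the closed
SUPERcritical collar `{p_c(t) ≤ p ≤ p_c(t) + ρ}` and may depend on `p`:

* `rate_eq_half_at_diagonal` — if the K⁺ inequality holds at the diagonal point `(t,t)`, `t ∈ (0,1)`,
  for every `η > 0` (with some `m(η)`) and a number `a₀` in place of `a(t,t)`, then `a₀ = 1/2`;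
* `kPlus_rate_eq_half_on_diagonal` — hence any K⁺ witness `(ρ, a)` on an arc through a level `t`
  whose collar contains the diagonal point (`p_c(t) ≤ t ≤ p_c(t) + ρ`) has `a(t,t) = 1/2`. The
  diagonal meets the supercritical collar exactly along `{(t,t) : p₃ ≤ t, t − p_c(t) ≤ ρ}`, a segment
  starting at the isotropic point `p₃ = p_c(ℤ³)` (where `p_c(p₃) = p₃`, the route's DiagonalOnCurve,
  proved inside `closes`) — so K⁺ leaves NO freedom there, for every `ρ`;
* `kPlus_rate_near_half` — with the Lipschitz clause, `|a(p,t) − 1/2| ≤ L |p − t|` on every collar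
  fibre through such a diagonal point: near the isotropic point the K⁺ field is `1/2 + O(|p − t|)`,
  i.e. (K⁺ ∧ K⁻ ⇒ `a(p_c(t),t) = −p_c′(t)`) the critical curve must leave the isotropic point with
  slope `−1/2 + O(t − p₃)` — a `C^{1,1}`-type constraint at `p₃` that any proof of K⁺ certifies;
* `supercritExchangeUniformity_pins_diagonal` — the same read off the crux itself (K⁺ as hypothesis).

Consistent with all Monte-Carlo evidence on the item (kit j023385, j024461, j026653: `a_n(p₃,p₃) − 1/2`
= `+0.0015(11), −0.0014(10), +0.0001(9), +0.0007(12)` at `n = 8, 12, 16, 20`; window profile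
`a_n(p₃ + x n^{−1/ν}, p₃) − 1/2 = O(n^{−1/ν})`), and the reason no small-`n` certificate against K⁺
can come from the diagonal. A tightness lemma — not a contradiction.
-/

noncomputable section

namespace Summit.CriticalPhenomena.PercolationContinuityZ3.Theorems.SupercritExchangeUniformity.Negative

open MeasureTheory Filter Topology
open Literature.Probability.Percolation Literature.Probability.LatticeModels
open Summit.CriticalPhenomena.PercolationContinuityZ3.Theorems.SubcritExchangeUniformity.Negative

/-- **Rigidity at a diagonal point.** If at `t ∈ (0,1)` the exchange-rate inequality
`|∂_tΘ_n(t,t) − a₀ ∂_pΘ_n(t,t)| ≤ η ∂_pΘ_n(t,t)` holds for EVERY `η > 0` and all `n ≥ m(η)`, then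
`a₀ = 1/2` (for every `n ≥ 1`: `∂_pΘ_n(t,t) = 2 ∂_tΘ_n(t,t) > 0`). [folklore] -/
theorem rate_eq_half_at_diagonal {t : ℝ} (ht : t ∈ Set.Ioo (0 : ℝ) 1) {a₀ : ℝ}
    (h : ∀ η > (0 : ℝ), ∃ m : ℕ, ∀ n ≥ m,
      |deriv (fun s => ThetaBox n t s) t - a₀ * deriv (fun q => ThetaBox n q t) t| ≤
        η * deriv (fun q => ThetaBox n q t) t) :
    a₀ = 1 / 2 := by
  by_contra hne
  have hgap : 0 < |1 / 2 - a₀| := abs_pos.2 (sub_ne_zero.2 (Ne.symm hne))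
  obtain ⟨m, hm⟩ := h (|1 / 2 - a₀| / 2) (half_pos hgap)
  have key := hm (max m 1) (le_max_left _ _)
  set D := deriv (fun q => ThetaBox (max m 1) q t) t with hDdef
  set T := deriv (fun s => ThetaBox (max m 1) t s) t with hTdef
  have hDT : D = 2 * T := Diag.deriv_p_eq_two_mul_deriv_t_diag (max m 1) ht
  have hT : 0 < T := deriv_t_pos (max m 1) (le_max_right _ _) ht.2 ht
  have hD : 0 < D := by rw [hDT]; linarith
  rw [show T = (1 / 2) * D by rw [hDT]; ring] at key
  rw [show (1 / 2) * D - a₀ * D = (1 / 2 - a₀) * D by ring, abs_mul, abs_of_pos hD] at key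
  have := mul_lt_mul_of_pos_right (half_lt_self hgap) hD
  linarith

/-- **K⁺ pins its field on the diagonal segment of the collar.** If a field `a` satisfies the
`η`-clause of K⁺ at the level `t ∈ (0,1)` on the collar `[p_c(t), p_c(t) + ρ]` for every `η > 0`,
and the diagonal point lies in that collar (`p_c(t) ≤ t ≤ p_c(t) + ρ` — true for `t ∈ [p₃, p₃ + ε(ρ)]`,
`p₃ = p_c(ℤ³)` the isotropic point), then `a(t,t) = 1/2`. [folklore] -/
theorem kPlus_rate_eq_half_on_diagonal {t ρ : ℝ} (ht : t ∈ Set.Ioo (0 : ℝ) 1) (h1 : pcurve t ≤ t)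
    (h2 : t ≤ pcurve t + ρ) {a : ℝ → ℝ → ℝ}
    (h : ∀ η > (0 : ℝ), ∃ m : ℕ, ∀ n ≥ m, ∀ p : ℝ, pcurve t ≤ p → p ≤ pcurve t + ρ →
      |deriv (fun s => ThetaBox n p s) t - a p t * deriv (fun q => ThetaBox n q t) p| ≤
        η * deriv (fun q => ThetaBox n q t) p) :
    a t t = 1 / 2 :=
  rate_eq_half_at_diagonal ht fun η hη => (h η hη).imp fun _ hm n hn => hm n hn t h1 h2

/-- **Near the diagonal the K⁺ field is `1/2 + O(|p − t|)`.** With the Lipschitz clause of K⁺ at the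
level `t` (constant `L`) and the diagonal point in the collar, `|a(p,t) − 1/2| ≤ L |p − t|` for every
`p` of the collar. [folklore] -/
theorem kPlus_rate_near_half {t ρ L : ℝ} (ht : t ∈ Set.Ioo (0 : ℝ) 1) (h1 : pcurve t ≤ t)
    (h2 : t ≤ pcurve t + ρ) {a : ℝ → ℝ → ℝ}
    (hLip : ∀ p q : ℝ, pcurve t ≤ p → p ≤ pcurve t + ρ → pcurve t ≤ q → q ≤ pcurve t + ρ →
      |a p t - a q t| ≤ L * |p - q|)
    (h : ∀ η > (0 : ℝ), ∃ m : ℕ, ∀ n ≥ m, ∀ p : ℝ, pcurve t ≤ p → p ≤ pcurve t + ρ →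
      |deriv (fun s => ThetaBox n p s) t - a p t * deriv (fun q => ThetaBox n q t) p| ≤
        η * deriv (fun q => ThetaBox n q t) p)
    {p : ℝ} (hp1 : pcurve t ≤ p) (hp2 : p ≤ pcurve t + ρ) :
    |a p t - 1 / 2| ≤ L * |p - t| := by
  rw [← kPlus_rate_eq_half_on_diagonal ht h1 h2 h]
  exact hLip p t hp1 hp2 h1 h2

/-- **Read off the crux.** `SupercritExchangeUniformity` (K⁺) implies: on every compact sub-arc
`[lo,hi] ⊂ (0,1)` its witness `(ρ, L, a)` — besides the three clauses of the crux — has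
`a(t,t) = 1/2` at every level `t ∈ [lo,hi]` whose collar contains the diagonal point, and
`|a(p,t) − 1/2| ≤ L |p − t|` along that collar fibre. (A consequence of the crux recorded as a
tightness remark; the crux is a hypothesis here, nothing asserts it.) [folklore] -/
theorem supercritExchangeUniformity_pins_diagonal
    (hK : Summit.CriticalPhenomena.PercolationContinuityZ3.Theses.PercExchangeRateTransport.SupercritExchangeUniformity)
    {lo hi : ℝ} (hlo : 0 < lo) (hlh : lo < hi) (hhi : hi < 1) :
    ∃ ρ > (0 : ℝ), ∃ L : ℝ, ∃ a : ℝ → ℝ → ℝ,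
      (∀ η > (0 : ℝ), ∃ m : ℕ, ∀ n ≥ m, ∀ t ∈ Set.Icc lo hi, ∀ p : ℝ,
        pcurve t ≤ p → p ≤ pcurve t + ρ →
          |deriv (fun s => ThetaBox n p s) t - a p t * deriv (fun q => ThetaBox n q t) p| ≤
            η * deriv (fun q => ThetaBox n q t) p) ∧
      (∀ t ∈ Set.Icc lo hi, pcurve t ≤ t → t ≤ pcurve t + ρ → a t t = 1 / 2) ∧
      ∀ t ∈ Set.Icc lo hi, pcurve t ≤ t → t ≤ pcurve t + ρ → ∀ p : ℝ,
        pcurve t ≤ p → p ≤ pcurve t + ρ → |a p t - 1 / 2| ≤ L * |p - t| := by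
  obtain ⟨ρ, hρ, L, a, -, hLip, hη⟩ := hK lo hi hlo hlh hhi
  have hηt : ∀ t ∈ Set.Icc lo hi, ∀ η > (0 : ℝ), ∃ m : ℕ, ∀ n ≥ m, ∀ p : ℝ,
      pcurve t ≤ p → p ≤ pcurve t + ρ →
        |deriv (fun s => ThetaBox n p s) t - a p t * deriv (fun q => ThetaBox n q t) p| ≤
          η * deriv (fun q => ThetaBox n q t) p :=
    fun t htI η hη' => (hη η hη').imp fun _ hm n hn p hp1 hp2 => hm n hn t htI p hp1 hp2
  have hIoo : ∀ t ∈ Set.Icc lo hi, t ∈ Set.Ioo (0 : ℝ) 1 :=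
    fun t htI => ⟨hlo.trans_le htI.1, htI.2.trans_lt hhi⟩
  refine ⟨ρ, hρ, L, a, fun η hη' => hη η hη', fun t htI h1 h2 => ?_, fun t htI h1 h2 p hp1 hp2 => ?_⟩
  · exact kPlus_rate_eq_half_on_diagonal (hIoo t htI) h1 h2 (hηt t htI)
  · exact kPlus_rate_near_half (hIoo t htI) h1 h2 (hLip t htI) (hηt t htI) hp1 hp2

end Summit.CriticalPhenomena.PercolationContinuityZ3.Theorems.SupercritExchangeUniformity.Negative

end
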